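import Summits.Ventures.PercRepro.S1ConeCandidates

/-!
# PercRepro — AT MOST NINETEEN CANDIDATES THROUGH A POINT ON THREE TRIANGLES (p2, gen 25; SUBCLAIM-S1 §6.9 (x))

On a `10`-point matroid with (C1), (C2) and circuits of size `≥ 3`, let `x` lie on exactly the three triangles
`L₁, L₂, L₃` and let `O` be the three points outside the cone `L₁ ∪ L₂ ∪ L₃`. The CANDIDATES are the `4`-subsets
`K ∋ x` of rank `3` containing no `Lᵢ`: every four-circuit through `x` is one, and so is `{x} ∪ T` for every
triangle `T` avoiding `x` (rank `3` by (C1), no `Lᵢ` inside as `T` would share two points with it) — and the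
latter are not circuits. The candidates number at most `19`: a candidate has points on two of the lines (`≤ 4` per
pair, S1ConeCandidates), or two outside points and a cone point (`≤ 2` per pair), or is `{x} ∪ O`
(`candidate_cases`: no candidate takes one point from each line, S1ConeGeometry (a)). Hence
**`#{four-circuits ∋ x} + #{triangles ∌ x} ≤ 19`**.

* `candidate_cases` — the seven-way split of a candidate;
* **`ncard_fourCircuits_through_add_triangles_avoiding_le`** — the theorem.
Axioms: standard.
-/

open scoped Matroid

namespace PercRepro

namespace S1

open Set

variable {α : Type}

/-- **THE CASES OF A CANDIDATE**: a `4`-set `K ∋ x` of rank `3` containing none of the three lines through `x`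
has points on two of the lines, or two outside points and a cone point, or is `{x} ∪ O`. -/
theorem candidate_cases (N : Matroid α) [N.Finite]
    (hC1 : ∀ L ⊆ N.E, N.eRk L = 2 → L.ncard ≤ 3) (hC2 : ∀ P ⊆ N.E, N.eRk P ≤ 3 → P.ncard ≤ 6)
    {x : α} {L₁ L₂ L₃ : Set α} (hL₁ : L₁ ∈ ThmN.trianglesThrough N x) (hL₂ : L₂ ∈ ThmN.trianglesThrough N x)
    (hL₃ : L₃ ∈ ThmN.trianglesThrough N x) (h12 : L₁ ≠ L₂) (h13 : L₁ ≠ L₃) (h23 : L₂ ≠ L₃)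
    {o₁ o₂ o₃ : α} (h12o : o₁ ≠ o₂) (h13o : o₁ ≠ o₃) (h23o : o₂ ≠ o₃)
    (hOeq : N.E \ (L₁ ∪ L₂ ∪ L₃) = {o₁, o₂, o₃})
    {K : Set α} (hKE : K ⊆ N.E) (hxK : x ∈ K) (hK4 : K.ncard = 4) (hKr : N.eRk K = 3)
    (hL₁K : ¬ L₁ ⊆ K) (hL₂K : ¬ L₂ ⊆ K) (hL₃K : ¬ L₃ ⊆ K) :
    (∃ a ∈ K, a ∈ L₁ ∧ a ≠ x ∧ ∃ b ∈ K, b ∈ L₂ ∧ b ≠ x) ∨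
    (∃ a ∈ K, a ∈ L₁ ∧ a ≠ x ∧ ∃ b ∈ K, b ∈ L₃ ∧ b ≠ x) ∨
    (∃ a ∈ K, a ∈ L₂ ∧ a ≠ x ∧ ∃ b ∈ K, b ∈ L₃ ∧ b ≠ x) ∨
    (o₁ ∈ K ∧ o₂ ∈ K ∧ ∃ a ∈ K, a ∈ L₁ ∪ L₂ ∪ L₃ ∧ a ≠ x) ∨
    (o₁ ∈ K ∧ o₃ ∈ K ∧ ∃ a ∈ K, a ∈ L₁ ∪ L₂ ∪ L₃ ∧ a ≠ x) ∨
    (o₂ ∈ K ∧ o₃ ∈ K ∧ ∃ a ∈ K, a ∈ L₁ ∪ L₂ ∪ L₃ ∧ a ≠ x) ∨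
    K = insert x (N.E \ (L₁ ∪ L₂ ∪ L₃)) := by
  set O := N.E \ (L₁ ∪ L₂ ∪ L₃) with hO
  have hEfin : N.E.Finite := N.ground_finite
  have hOfin : O.Finite := hEfin.subset sdiff_subset
  have hO3 : O.ncard = 3 := by
    rw [hOeq, Set.ncard_insert_of_notMem (by simp [h12o, h13o]), Set.ncard_pair h23o]
  obtain ⟨u, v, w, hux, hvx, hwx, huv, huw, hvw, hKeq⟩ := exists_eq_insert_three_of_ncard_four hK4 hxK
  have huK : u ∈ K := by rw [hKeq]; simp
  have hvK : v ∈ K := by rw [hKeq]; simp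
  have hwK : w ∈ K := by rw [hKeq]; simp
  have hclass : ∀ y ∈ K, (y ∈ L₁ ∨ y ∈ L₂ ∨ y ∈ L₃) ∨ y ∈ O := by
    intro y hy
    by_cases h : y ∈ L₁ ∪ L₂ ∪ L₃
    · left
      rcases h with (h | h) | h
      · exact Or.inl h
      · exact Or.inr (Or.inl h)
      · exact Or.inr (Or.inr h)
    · right; exact ⟨hKE hy, h⟩
  -- two cone points on different lines
  have hF : ∀ p q, p ∈ K → q ∈ K → p ≠ q → p ≠ x → q ≠ x → (p ∈ L₁ ∨ p ∈ L₂ ∨ p ∈ L₃) →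
      (q ∈ L₁ ∨ q ∈ L₂ ∨ q ∈ L₃) →
      (∃ a ∈ K, a ∈ L₁ ∧ a ≠ x ∧ ∃ b ∈ K, b ∈ L₂ ∧ b ≠ x) ∨
      (∃ a ∈ K, a ∈ L₁ ∧ a ≠ x ∧ ∃ b ∈ K, b ∈ L₃ ∧ b ≠ x) ∨
      (∃ a ∈ K, a ∈ L₂ ∧ a ≠ x ∧ ∃ b ∈ K, b ∈ L₃ ∧ b ≠ x) := by
    intro p q hp hq hpq hpx hqx hpL hqL
    rcases hpL with hp1 | hp2 | hp3 <;> rcases hqL with hq1 | hq2 | hq3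
    · exact (not_two_of_line hL₁ hxK hL₁K hp hq hpq hpx hqx hp1 hq1).elim
    · exact Or.inl ⟨p, hp, hp1, hpx, q, hq, hq2, hqx⟩
    · exact Or.inr (Or.inl ⟨p, hp, hp1, hpx, q, hq, hq3, hqx⟩)
    · exact Or.inl ⟨q, hq, hq1, hqx, p, hp, hp2, hpx⟩
    · exact (not_two_of_line hL₂ hxK hL₂K hp hq hpq hpx hqx hp2 hq2).elim
    · exact Or.inr (Or.inr ⟨p, hp, hp2, hpx, q, hq, hq3, hqx⟩)
    · exact Or.inr (Or.inl ⟨q, hq, hq1, hqx, p, hp, hp3, hpx⟩)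
    · exact Or.inr (Or.inr ⟨q, hq, hq2, hqx, p, hp, hp3, hpx⟩)
    · exact (not_two_of_line hL₃ hxK hL₃K hp hq hpq hpx hqx hp3 hq3).elim
  -- two outside points and a cone point
  have hG : ∀ s t a, s ∈ K → t ∈ K → a ∈ K → s ≠ t → a ≠ x → s ∈ O → t ∈ O →
      (a ∈ L₁ ∨ a ∈ L₂ ∨ a ∈ L₃) →
      (o₁ ∈ K ∧ o₂ ∈ K ∧ ∃ a ∈ K, a ∈ L₁ ∪ L₂ ∪ L₃ ∧ a ≠ x) ∨
      (o₁ ∈ K ∧ o₃ ∈ K ∧ ∃ a ∈ K, a ∈ L₁ ∪ L₂ ∪ L₃ ∧ a ≠ x) ∨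
      (o₂ ∈ K ∧ o₃ ∈ K ∧ ∃ a ∈ K, a ∈ L₁ ∪ L₂ ∪ L₃ ∧ a ≠ x) := by
    intro s t a hs ht ha hst hax hsO htO haL
    have hacone : a ∈ L₁ ∪ L₂ ∪ L₃ := by
      rcases haL with h | h | h
      · exact Or.inl (Or.inl h)
      · exact Or.inl (Or.inr h)
      · exact Or.inr h
    have hsO' : s = o₁ ∨ s = o₂ ∨ s = o₃ := by
      have h := hsO; rw [hOeq] at h; simpa using h
    have htO' : t = o₁ ∨ t = o₂ ∨ t = o₃ := by
      have h := htO; rw [hOeq] at h; simpa using h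
    rcases hsO' with rfl | rfl | rfl <;> rcases htO' with rfl | rfl | rfl
    · exact absurd rfl hst
    · exact Or.inl ⟨hs, ht, a, ha, hacone, hax⟩
    · exact Or.inr (Or.inl ⟨hs, ht, a, ha, hacone, hax⟩)
    · exact Or.inl ⟨ht, hs, a, ha, hacone, hax⟩
    · exact absurd rfl hst
    · exact Or.inr (Or.inr ⟨hs, ht, a, ha, hacone, hax⟩)
    · exact Or.inr (Or.inl ⟨ht, hs, a, ha, hacone, hax⟩)
    · exact Or.inr (Or.inr ⟨ht, hs, a, ha, hacone, hax⟩)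
    · exact absurd rfl hst
  -- three cone points: one on each line, impossible
  have hfinal : ∀ a₁ a₂ a₃, a₁ ∈ K → a₂ ∈ K → a₃ ∈ K → a₁ ∈ L₁ → a₂ ∈ L₂ → a₃ ∈ L₃ → a₁ ≠ x → a₂ ≠ x →
      a₃ ≠ x → False := by
    intro a₁ a₂ a₃ ha₁ ha₂ ha₃ h1 h2 h3 hx1 hx2 hx3
    have hne : ∀ {a b : α} {L L' : Set α}, L ∈ ThmN.trianglesThrough N x → L' ∈ ThmN.trianglesThrough N x →
        L ≠ L' → a ∈ L → b ∈ L' → a ≠ x → a ≠ b := by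
      intro a b L L' hL hL' hne ha hb hax hab
      have hint := ThmN.inter_eq_singleton_of_mem_trianglesThrough N hC1 hL hL' hne
      have : a ∈ L ∩ L' := ⟨ha, hab ▸ hb⟩
      rw [hint] at this
      exact hax this
    have h12' : a₁ ≠ a₂ := hne hL₁ hL₂ h12 h1 h2 hx1
    have h13' : a₁ ≠ a₃ := hne hL₁ hL₃ h13 h1 h3 hx1
    have h23' : a₂ ≠ a₃ := hne hL₂ hL₃ h23 h2 h3 hx2
    have hsub : ({x, a₁, a₂, a₃} : Set α) ⊆ K := by rintro z (rfl | rfl | rfl | rfl) <;> assumption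
    have hcard : ({x, a₁, a₂, a₃} : Set α).ncard = 4 := by
      rw [Set.ncard_insert_of_notMem (by simp [Ne.symm hx1, Ne.symm hx2, Ne.symm hx3]),
        Set.ncard_insert_of_notMem (by simp [h12', h13']), Set.ncard_pair h23']
    have heq : ({x, a₁, a₂, a₃} : Set α) = K :=
      Set.eq_of_subset_of_ncard_le hsub (by rw [hcard, hK4]) (hEfin.subset hKE)
    rw [← heq] at hKr
    exact not_eRk_three_cone N hC1 hC2 hL₁ hL₂ hL₃ h12 h13 h23 h1 hx1 h2 hx2 h3 hx3 hKr
  have hthree : ∀ p q r, p ∈ K → q ∈ K → r ∈ K → p ≠ q → p ≠ r → q ≠ r → p ≠ x → q ≠ x → r ≠ x →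
      (p ∈ L₁ ∨ p ∈ L₂ ∨ p ∈ L₃) → (q ∈ L₁ ∨ q ∈ L₂ ∨ q ∈ L₃) → (r ∈ L₁ ∨ r ∈ L₂ ∨ r ∈ L₃) → False := by
    intro p q r hp hq hr hpq hpr hqr hpx hqx hrx hpL hqL hrL
    rcases hpL with hp1 | hp2 | hp3 <;> rcases hqL with hq1 | hq2 | hq3 <;> rcases hrL with hr1 | hr2 | hr3
    all_goals first
      | exact not_two_of_line hL₁ hxK hL₁K hp hq hpq hpx hqx ‹p ∈ L₁› ‹q ∈ L₁›
      | exact not_two_of_line hL₂ hxK hL₂K hp hq hpq hpx hqx ‹p ∈ L₂› ‹q ∈ L₂›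
      | exact not_two_of_line hL₃ hxK hL₃K hp hq hpq hpx hqx ‹p ∈ L₃› ‹q ∈ L₃›
      | exact not_two_of_line hL₁ hxK hL₁K hp hr hpr hpx hrx ‹p ∈ L₁› ‹r ∈ L₁›
      | exact not_two_of_line hL₂ hxK hL₂K hp hr hpr hpx hrx ‹p ∈ L₂› ‹r ∈ L₂›
      | exact not_two_of_line hL₃ hxK hL₃K hp hr hpr hpx hrx ‹p ∈ L₃› ‹r ∈ L₃›
      | exact not_two_of_line hL₁ hxK hL₁K hq hr hqr hqx hrx ‹q ∈ L₁› ‹r ∈ L₁›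
      | exact not_two_of_line hL₂ hxK hL₂K hq hr hqr hqx hrx ‹q ∈ L₂› ‹r ∈ L₂›
      | exact not_two_of_line hL₃ hxK hL₃K hq hr hqr hqx hrx ‹q ∈ L₃› ‹r ∈ L₃›
      | exact hfinal p q r hp hq hr ‹p ∈ L₁› ‹q ∈ L₂› ‹r ∈ L₃› hpx hqx hrx
      | exact hfinal p r q hp hr hq ‹p ∈ L₁› ‹r ∈ L₂› ‹q ∈ L₃› hpx hrx hqx
      | exact hfinal q p r hq hp hr ‹q ∈ L₁› ‹p ∈ L₂› ‹r ∈ L₃› hqx hpx hrx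
      | exact hfinal q r p hq hr hp ‹q ∈ L₁› ‹r ∈ L₂› ‹p ∈ L₃› hqx hrx hpx
      | exact hfinal r p q hr hp hq ‹r ∈ L₁› ‹p ∈ L₂› ‹q ∈ L₃› hrx hpx hqx
      | exact hfinal r q p hr hq hp ‹r ∈ L₁› ‹q ∈ L₂› ‹p ∈ L₃› hrx hqx hpx
  -- three outside points
  have hO3' : ∀ p q r, p ≠ q → p ≠ r → q ≠ r → p ∈ O → q ∈ O → r ∈ O → ({p, q, r} : Set α) = O := by
    intro p q r hpq hpr hqr hp hq hr
    refine Set.eq_of_subset_of_ncard_le (by rintro z (rfl | rfl | rfl) <;> assumption) ?_ hOfin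
    rw [hO3, Set.ncard_insert_of_notMem (by simp [hpq, hpr]), Set.ncard_pair hqr]
  rcases hclass u huK with hu | hu <;> rcases hclass v hvK with hv | hv <;> rcases hclass w hwK with hw | hw
  · exact (hthree u v w huK hvK hwK huv huw hvw hux hvx hwx hu hv hw).elim
  · rcases hF u v huK hvK huv hux hvx hu hv with h | h | h
    · exact Or.inl h
    · exact Or.inr (Or.inl h)
    · exact Or.inr (Or.inr (Or.inl h))
  · rcases hF u w huK hwK huw hux hwx hu hw with h | h | h
    · exact Or.inl h
    · exact Or.inr (Or.inl h)
    · exact Or.inr (Or.inr (Or.inl h))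
  · rcases hG v w u hvK hwK huK hvw hux hv hw hu with h | h | h
    · exact Or.inr (Or.inr (Or.inr (Or.inl h)))
    · exact Or.inr (Or.inr (Or.inr (Or.inr (Or.inl h))))
    · exact Or.inr (Or.inr (Or.inr (Or.inr (Or.inr (Or.inl h)))))
  · rcases hF v w hvK hwK hvw hvx hwx hv hw with h | h | h
    · exact Or.inl h
    · exact Or.inr (Or.inl h)
    · exact Or.inr (Or.inr (Or.inl h))
  · rcases hG u w v huK hwK hvK huw hvx hu hw hv with h | h | h
    · exact Or.inr (Or.inr (Or.inr (Or.inl h)))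
    · exact Or.inr (Or.inr (Or.inr (Or.inr (Or.inl h))))
    · exact Or.inr (Or.inr (Or.inr (Or.inr (Or.inr (Or.inl h)))))
  · rcases hG u v w huK hvK hwK huv hwx hu hv hw with h | h | h
    · exact Or.inr (Or.inr (Or.inr (Or.inl h)))
    · exact Or.inr (Or.inr (Or.inr (Or.inr (Or.inl h))))
    · exact Or.inr (Or.inr (Or.inr (Or.inr (Or.inr (Or.inl h)))))
  · right; right; right; right; right; right
    rw [hKeq, ← hO3' u v w huv huw hvw hu hv hw]


open Classical in
/-- **AT MOST NINETEEN CANDIDATES**: on a `10`-point matroid with (C1), (C2) and circuits of size `≥ 3`, if `x`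
lies exactly on the three triangles `L₁, L₂, L₃`, then `#{four-circuits ∋ x} + #{triangles ∌ x} ≤ 19`. -/
theorem ncard_fourCircuits_through_add_triangles_avoiding_le (N : Matroid α) [N.Finite]
    (hC1 : ∀ L ⊆ N.E, N.eRk L = 2 → L.ncard ≤ 3) (hC2 : ∀ P ⊆ N.E, N.eRk P ≤ 3 → P.ncard ≤ 6)
    (hcirc : ∀ C, N.IsCircuit C → 3 ≤ C.ncard) {x : α} (hn : N.E.ncard = 10)
    {L₁ L₂ L₃ : Set α} (hL₁ : L₁ ∈ ThmN.trianglesThrough N x) (hL₂ : L₂ ∈ ThmN.trianglesThrough N x)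
    (hL₃ : L₃ ∈ ThmN.trianglesThrough N x) (h12 : L₁ ≠ L₂) (h13 : L₁ ≠ L₃) (h23 : L₂ ≠ L₃)
    (hall : ∀ C ∈ ThmN.trianglesThrough N x, C = L₁ ∨ C = L₂ ∨ C = L₃) :
    {C : Set α | N.IsCircuit C ∧ C.ncard = 4 ∧ x ∈ C}.ncard +
      {C : Set α | N.IsCircuit C ∧ C.ncard = 3 ∧ x ∉ C}.ncard ≤ 19 := by
  have hEfin : N.E.Finite := N.ground_finite
  have hL₁E := hL₁.1.subset_ground
  have hL₂E := hL₂.1.subset_ground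
  have hL₃E := hL₃.1.subset_ground
  have hxE : x ∈ N.E := hL₁E hL₁.2.2
  have hconeE : L₁ ∪ L₂ ∪ L₃ ⊆ N.E := Set.union_subset (Set.union_subset hL₁E hL₂E) hL₃E
  have hconefin : (L₁ ∪ L₂ ∪ L₃).Finite := hEfin.subset hconeE
  -- the cone has `7` points, the outside `O` has `3`
  have hcone7 : (L₁ ∪ L₂ ∪ L₃).ncard = 7 := by
    have h5 := ncard_union_eq_five_of_trianglesThrough N hC1 hL₁ hL₂ h12
    have hint : (L₁ ∪ L₂) ∩ L₃ = {x} := by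
      rw [Set.union_inter_distrib_right, ThmN.inter_eq_singleton_of_mem_trianglesThrough N hC1 hL₁ hL₃ h13,
        ThmN.inter_eq_singleton_of_mem_trianglesThrough N hC1 hL₂ hL₃ h23, Set.union_self]
    have h := Set.ncard_union_add_ncard_inter (L₁ ∪ L₂) L₃ (hEfin.subset (Set.union_subset hL₁E hL₂E))
      (hEfin.subset hL₃E)
    rw [hint, Set.ncard_singleton, h5, hL₃.2.1] at h
    omega
  set O := N.E \ (L₁ ∪ L₂ ∪ L₃) with hO
  have hO3 : O.ncard = 3 := by rw [hO, Set.ncard_sdiff hconeE hconefin, hn, hcone7]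
  have hOfin : O.Finite := hEfin.subset sdiff_subset
  have hOE : O ⊆ N.E := sdiff_subset
  have hOx : x ∉ O := fun h => h.2 (Or.inl (Or.inl hL₁.2.2))
  have hnotri : ∀ s ∈ O, ∀ C ∈ ThmN.trianglesThrough N x, s ∉ C := by
    intro s hs C hC hsC
    rcases hall C hC with rfl | rfl | rfl
    · exact hs.2 (Or.inl (Or.inl hsC))
    · exact hs.2 (Or.inl (Or.inr hsC))
    · exact hs.2 (Or.inr hsC)
  -- the candidates
  set 𝒦 := {K : Set α | K ⊆ N.E ∧ x ∈ K ∧ K.ncard = 4 ∧ N.eRk K = 3 ∧ ¬ L₁ ⊆ K ∧ ¬ L₂ ⊆ K ∧ ¬ L₃ ⊆ K}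
    with h𝒦
  have h𝒦fin : 𝒦.Finite := hEfin.finite_subsets.subset (fun K hK => hK.1)
  have h𝒦spec : ∀ K ∈ 𝒦, K ⊆ N.E ∧ x ∈ K ∧ K.ncard = 4 ∧ N.eRk K = 3 ∧ ¬ L₁ ⊆ K ∧ ¬ L₂ ⊆ K ∧ ¬ L₃ ⊆ K :=
    fun K hK => hK
  have hfinE : ∀ X ⊆ N.E, N.eRk X ≠ ⊤ := fun X hX =>
    ((N.eRk_le_encard X).trans_lt (hEfin.subset hX).encard_lt_top).ne
  ----------------------------------------------------------------
  -- (1) the four-circuits through `x` and the sets `{x} ∪ T` are candidates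
  ----------------------------------------------------------------
  set A := {C : Set α | N.IsCircuit C ∧ C.ncard = 4 ∧ x ∈ C} with hA
  set 𝒯' := {C : Set α | N.IsCircuit C ∧ C.ncard = 3 ∧ x ∉ C} with h𝒯'
  have hA𝒦 : A ⊆ 𝒦 := by
    rintro C ⟨hC, h4, hxC⟩
    have hCE := hC.subset_ground
    have hCfin : C.Finite := hEfin.subset hCE
    refine ⟨hCE, hxC, h4, ?_, ?_, ?_, ?_⟩
    · have h := hC.eRk_add_one_eq
      rw [← hCfin.cast_ncard_eq, h4] at h
      obtain ⟨r, hr⟩ := ENat.ne_top_iff_exists.1 (hfinE C hCE)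
      rw [← hr] at h ⊢
      have : r + 1 = 4 := by exact_mod_cast h
      norm_cast; omega
    · intro hsub
      have h := hL₁.1.eq_of_subset_isCircuit hC hsub
      have h3 := hL₁.2.1
      rw [h] at h3; omega
    · intro hsub
      have h := hL₂.1.eq_of_subset_isCircuit hC hsub
      have h3 := hL₂.2.1
      rw [h] at h3; omega
    · intro hsub
      have h := hL₃.1.eq_of_subset_isCircuit hC hsub
      have h3 := hL₃.2.1
      rw [h] at h3; omega
  have hB𝒦 : (insert x) '' 𝒯' ⊆ 𝒦 := by
    rintro K ⟨T, ⟨hT, hT3, hxT⟩, rfl⟩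
    have hTE := hT.subset_ground
    have hTfin : T.Finite := hEfin.subset hTE
    have hTr : N.eRk T = 2 := by
      have h := hT.eRk_add_one_eq
      rw [← hTfin.cast_ncard_eq, hT3] at h
      obtain ⟨r, hr⟩ := ENat.ne_top_iff_exists.1 (hfinE T hTE)
      rw [← hr] at h ⊢
      have : r + 1 = 3 := by exact_mod_cast h
      norm_cast; omega
    have hnoL : ∀ L ∈ ThmN.trianglesThrough N x, ¬ L ⊆ insert x T := by
      intro L hL hsub
      have hLfin : L.Finite := hEfin.subset hL.1.subset_ground
      have h2 : (L \ {x}).ncard = 2 := by rw [Set.ncard_sdiff_singleton_of_mem hL.2.2, hL.2.1]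
      obtain ⟨y, z, hyz, hyz'⟩ := Set.ncard_eq_two.1 h2
      have hy : y ∈ L \ {x} := by rw [hyz']; simp
      have hz : z ∈ L \ {x} := by rw [hyz']; simp
      have hyT : y ∈ T := by
        have := hsub hy.1
        rcases this with h | h
        · exact absurd h hy.2
        · exact h
      have hzT : z ∈ T := by
        have := hsub hz.1
        rcases this with h | h
        · exact absurd h hz.2
        · exact h
      have hTy : T ∈ ThmN.trianglesThrough N y := ⟨hT, hT3, hyT⟩
      have hLy : L ∈ ThmN.trianglesThrough N y := ⟨hL.1, hL.2.1, hy.1⟩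
      have hneTL : T ≠ L := fun h => hxT (h ▸ hL.2.2)
      have hint := ThmN.inter_eq_singleton_of_mem_trianglesThrough N hC1 hTy hLy hneTL
      have : z ∈ T ∩ L := ⟨hzT, hz.1⟩
      rw [hint] at this
      exact hyz (Set.mem_singleton_iff.1 this).symm
    refine ⟨Set.insert_subset hxE hTE, Set.mem_insert x T, ?_, ?_, hnoL L₁ hL₁, hnoL L₂ hL₂, hnoL L₃ hL₃⟩
    · rw [Set.ncard_insert_of_notMem hxT hTfin, hT3]
    · have hle : N.eRk (insert x T) ≤ 3 := by
        calc N.eRk (insert x T) ≤ N.eRk T + 1 := N.eRk_insert_le_add_one x T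
          _ = 3 := by rw [hTr]; rfl
      obtain ⟨r, hr⟩ := ENat.ne_top_iff_exists.1 (hfinE _ (Set.insert_subset hxE hTE))
      have hr3 : r ≤ 3 := by rw [← hr] at hle; exact_mod_cast hle
      have hr2 : ¬ r ≤ 2 := by
        intro hr2
        have hle2 : N.eRk (insert x T) ≤ N.eRk T := by
          rw [← hr, hTr]; exact_mod_cast hr2
        have := mem_closure_of_eRk_insert_le N hTE hxE hle2
        rw [closure_eq_of_triangle N hC1 hT hT3] at this
        exact hxT this
      rw [← hr]
      norm_cast; omega
  have hdisj : Disjoint A ((insert x) '' 𝒯') := by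
    rw [Set.disjoint_left]
    rintro K ⟨hK, -, -⟩ ⟨T, ⟨hT, -, hxT⟩, rfl⟩
    exact hK.not_ssubset hT (Set.ssubset_insert hxT)
  have hAfin : A.Finite := (finite_fourCircuits N).subset (fun C hC => ⟨hC.1, hC.2.1⟩)
  have h𝒯'fin : 𝒯'.Finite := (finite_triangles N).subset (fun C hC => ⟨hC.1, hC.2.1⟩)
  have hBcard : ((insert x) '' 𝒯').ncard = 𝒯'.ncard := by
    apply Set.InjOn.ncard_image
    rintro T ⟨-, -, hxT⟩ T' ⟨-, -, hxT'⟩ h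
    ext y
    constructor
    · intro hy
      have : y ∈ insert x T' := h ▸ Set.mem_insert_of_mem x hy
      rcases this with rfl | h'
      · exact absurd hy hxT
      · exact h'
    · intro hy
      have : y ∈ insert x T := h ▸ Set.mem_insert_of_mem x hy
      rcases this with rfl | h'
      · exact absurd hy hxT'
      · exact h'
  have hstep1 : A.ncard + 𝒯'.ncard ≤ 𝒦.ncard := by
    rw [← hBcard, ← Set.ncard_union_eq hdisj hAfin (h𝒯'fin.image _)]
    exact Set.ncard_le_ncard (Set.union_subset hA𝒦 hB𝒦) h𝒦fin
  refine hstep1.trans ?_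
  ----------------------------------------------------------------
  -- (2) the candidates number at most `19`
  ----------------------------------------------------------------
  obtain ⟨o₁, o₂, o₃, h12o, h13o, h23o, hOeq⟩ := Set.ncard_eq_three.1 hO3
  have ho₁ : o₁ ∈ O := by rw [hOeq]; simp
  have ho₂ : o₂ ∈ O := by rw [hOeq]; simp
  have ho₃ : o₃ ∈ O := by rw [hOeq]; simp
  set F₁₂ := {K ∈ 𝒦 | ∃ a ∈ K, a ∈ L₁ ∧ a ≠ x ∧ ∃ b ∈ K, b ∈ L₂ ∧ b ≠ x} with hF₁₂
  set F₁₃ := {K ∈ 𝒦 | ∃ a ∈ K, a ∈ L₁ ∧ a ≠ x ∧ ∃ b ∈ K, b ∈ L₃ ∧ b ≠ x} with hF₁₃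
  set F₂₃ := {K ∈ 𝒦 | ∃ a ∈ K, a ∈ L₂ ∧ a ≠ x ∧ ∃ b ∈ K, b ∈ L₃ ∧ b ≠ x} with hF₂₃
  set G₁₂ := {K ∈ 𝒦 | o₁ ∈ K ∧ o₂ ∈ K ∧ ∃ a ∈ K, a ∈ L₁ ∪ L₂ ∪ L₃ ∧ a ≠ x} with hG₁₂
  set G₁₃ := {K ∈ 𝒦 | o₁ ∈ K ∧ o₃ ∈ K ∧ ∃ a ∈ K, a ∈ L₁ ∪ L₂ ∪ L₃ ∧ a ≠ x} with hG₁₃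
  set G₂₃ := {K ∈ 𝒦 | o₂ ∈ K ∧ o₃ ∈ K ∧ ∃ a ∈ K, a ∈ L₁ ∪ L₂ ∪ L₃ ∧ a ≠ x} with hG₂₃
  have hF₁₂c : F₁₂.ncard ≤ 4 :=
    ncard_candidates_two_lines_le_four N hC1 hC2 hL₁ hL₂ hL₃ h12 h13 h23 𝒦 h𝒦spec
  have hF₁₃c : F₁₃.ncard ≤ 4 :=
    ncard_candidates_two_lines_le_four N hC1 hC2 hL₁ hL₃ hL₂ h13 h12 (Ne.symm h23) 𝒦
      (fun K hK => ⟨hK.1, hK.2.1, hK.2.2.1, hK.2.2.2.1, hK.2.2.2.2.1, hK.2.2.2.2.2.2, hK.2.2.2.2.2.1⟩)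
  have hF₂₃c : F₂₃.ncard ≤ 4 :=
    ncard_candidates_two_lines_le_four N hC1 hC2 hL₂ hL₃ hL₁ h23 (Ne.symm h12) (Ne.symm h13) 𝒦
      (fun K hK => ⟨hK.1, hK.2.1, hK.2.2.1, hK.2.2.2.1, hK.2.2.2.2.2.1, hK.2.2.2.2.2.2, hK.2.2.2.2.1⟩)
  have hGc : ∀ s t, s ∈ O → t ∈ O → s ≠ t →
      {K ∈ 𝒦 | s ∈ K ∧ t ∈ K ∧ ∃ a ∈ K, a ∈ L₁ ∪ L₂ ∪ L₃ ∧ a ≠ x}.ncard ≤ 2 :=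
    fun s t hs ht hst => ncard_candidates_pair_le_two N hC1 hC2 hcirc hL₁ hL₂ hL₃ 𝒦
      (fun K hK => ⟨hK.1, hK.2.1, hK.2.2.1, hK.2.2.2.1⟩) (hOE hs) (hOE ht) hst hs.2 ht.2 (hnotri s hs)
  have hG₁₂c : G₁₂.ncard ≤ 2 := hGc o₁ o₂ ho₁ ho₂ h12o
  have hG₁₃c : G₁₃.ncard ≤ 2 := hGc o₁ o₃ ho₁ ho₃ h13o
  have hG₂₃c : G₂₃.ncard ≤ 2 := hGc o₂ o₃ ho₂ ho₃ h23o
  have hsub : 𝒦 ⊆ F₁₂ ∪ F₁₃ ∪ F₂₃ ∪ G₁₂ ∪ G₁₃ ∪ G₂₃ ∪ {insert x O} := by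
    intro K hK
    obtain ⟨hKE, hxK, hK4, hKr, hL₁K, hL₂K, hL₃K⟩ := h𝒦spec K hK
    rcases candidate_cases N hC1 hC2 hL₁ hL₂ hL₃ h12 h13 h23 h12o h13o h23o hOeq hKE hxK hK4 hKr hL₁K hL₂K hL₃K
      with h | h | h | h | h | h | h
    · exact Or.inl (Or.inl (Or.inl (Or.inl (Or.inl (Or.inl ⟨hK, h⟩)))))
    · exact Or.inl (Or.inl (Or.inl (Or.inl (Or.inl (Or.inr ⟨hK, h⟩)))))
    · exact Or.inl (Or.inl (Or.inl (Or.inl (Or.inr ⟨hK, h⟩))))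
    · exact Or.inl (Or.inl (Or.inl (Or.inr ⟨hK, h⟩)))
    · exact Or.inl (Or.inl (Or.inr ⟨hK, h⟩))
    · exact Or.inl (Or.inr ⟨hK, h⟩)
    · exact Or.inr (by rw [h]; exact Set.mem_singleton _)
  have hfinF : ∀ S : Set (Set α), S ⊆ 𝒦 → S.Finite := fun S hS => h𝒦fin.subset hS
  have hfinU : (F₁₂ ∪ F₁₃ ∪ F₂₃ ∪ G₁₂ ∪ G₁₃ ∪ G₂₃ ∪ {insert x O}).Finite :=
    (((((((hfinF F₁₂ (fun K hK => hK.1)).union (hfinF F₁₃ (fun K hK => hK.1))).union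
      (hfinF F₂₃ (fun K hK => hK.1))).union (hfinF G₁₂ (fun K hK => hK.1))).union
      (hfinF G₁₃ (fun K hK => hK.1))).union (hfinF G₂₃ (fun K hK => hK.1))).union (Set.finite_singleton _))
  have hU1 := Set.ncard_union_le F₁₂ F₁₃
  have hU2 := Set.ncard_union_le (F₁₂ ∪ F₁₃) F₂₃
  have hU3 := Set.ncard_union_le (F₁₂ ∪ F₁₃ ∪ F₂₃) G₁₂
  have hU4 := Set.ncard_union_le (F₁₂ ∪ F₁₃ ∪ F₂₃ ∪ G₁₂) G₁₃
  have hU5 := Set.ncard_union_le (F₁₂ ∪ F₁₃ ∪ F₂₃ ∪ G₁₂ ∪ G₁₃) G₂₃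
  have hU6 := Set.ncard_union_le (F₁₂ ∪ F₁₃ ∪ F₂₃ ∪ G₁₂ ∪ G₁₃ ∪ G₂₃) ({insert x O} : Set (Set α))
  have hH : ({insert x O} : Set (Set α)).ncard = 1 := Set.ncard_singleton _
  have := Set.ncard_le_ncard hsub hfinU
  omega

end S1

end PercRepro
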